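import Literature.Barriers.PneNP.NPHardnessToOneWayFunctionsMsg1Prog
import Literature.Barriers.PneNP.NPHardnessToOneWayFunctionsMsg3Form
import HarnessLib

/-!
# Barrier `NPHardnessToOneWayFunctions` (AGGM 2006, Thm. 4): the numbers of message 3

App. D campaign (design v3), machine part M2-iv, of the discharge of
`Literature.Barriers.PneNP.AkaviaEtAl2006_complMemAM`.

The sizes, widths and offsets that the programme of message 3 (`…Msg3Prog.lean`) needs, as
FROZEN numbers (irreducible wrappers related to the abstract quantities by their `_def` lemmas —
cf. the lesson recorded in `…Msg1Prog.lean`: unification must never evaluate arithmetic on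
literals), each computed in polynomial time from the input (`…N`), and all inside the coin string,
hence below the universal unary budget (`end_eq_cLen`, `le_end_*`). All proved, no named facts.

## References

* [AkaviaEtAl2006] A. Akavia, O. Goldreich, S. Goldwasser, D. Moshkovitz, *On basing one-way
  functions on NP-hardness*, STOC 2006; preprint App. D (printed p. 21).
* [AroraBarakCC2009] S. Arora, B. Barak, *Computational Complexity: A Modern Approach*, CUP 2009,
  §1.2–1.3.
-/

noncomputable section

namespace Literature.Barriers.PneNP

open Finset Polynomial Literature.Computability.Complexity Literature.Computability.Cryptography
  _root_.Computability CodeFP Plumb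

open scoped Classical

namespace AppD

open Sizes Par

variable (R : OracleAdversary Bool) (x : List Bool)

/-! ### Closed forms -/

/-- **Gauss**: `Σ_{λ ≤ n} (λ n + λ) = (n + 1) · (n (n + 1) / 2)`. [folklore] -/
theorem sigma_closed (n : ℕ) : (∑ lam : Fin (n + 1), ((lam : ℕ) * n + lam)) = (n + 1) * (n * (n + 1) / 2) := by
  have h1 : (∑ lam : Fin (n + 1), ((lam : ℕ) * n + lam)) = (∑ i ∈ Finset.range (n + 1), i) * (n + 1) := by
    rw [Finset.sum_mul, Fin.sum_univ_eq_sum_range (fun i => i * n + i) (n + 1)]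
    exact Finset.sum_congr rfl fun i _ => by ring
  rw [h1, Finset.sum_range_id_mul_two' n]
  where
  /-- `Σ_{i ≤ n} i = n (n+1) / 2`. -/
  Finset.sum_range_id_mul_two' (n : ℕ) : (∑ i ∈ Finset.range (n + 1), i) * (n + 1) = (n + 1) * (n * (n + 1) / 2) := by
    rw [Finset.sum_range_id, Nat.add_sub_cancel, Nat.mul_comm ((n + 1) * n / 2), Nat.mul_comm (n + 1) n]

/-- `Nat.size` of a positive number is `⌊log₂⌋ + 1`. [folklore] -/
theorem size_eq_log_succ {k : ℕ} (hk : k ≠ 0) : Nat.size k = Nat.log 2 k + 1 := by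
  apply le_antisymm
  · exact Nat.size_le.2 (Nat.lt_pow_succ_log_self (by norm_num) k)
  · exact Nat.lt_size.2 (Nat.pow_log_le_self 2 hk)

/-! ### Frozen numbers -/

/-- `c = T³`, frozen. [folklore] -/
def cv : ℕ := (Iw R x).prm.c
/-- `u = T⁸`, frozen. [folklore] -/
def uv : ℕ := (Iw R x).u
/-- `kmaxG`, frozen. [folklore] -/
def kmaxGv : ℕ := (Iw R x).kmaxG
/-- `kmaxA`, frozen. [folklore] -/
def kmaxAv : ℕ := (Iw R x).kmaxA
/-- `b₀`, frozen. [folklore] -/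
def b0v : ℕ := (Iw R x).b₀
/-- `dCF = cn + n + F`, frozen. [folklore] -/
def dCFv : ℕ := dCF R x (fbitsOf R x.length)
/-- `GSTest.M` for the seeds, frozen. [folklore] -/
def MG1v : ℕ := GSTest.M (d := dCF R x (fbitsOf R x.length)) (Iw R x).prm.c (Iw R x).kmaxG
/-- `GSTest.M` for `𝔽₂ⁿ`, frozen. [folklore] -/
def MG2v : ℕ := GSTest.M (d := x.length) (Iw R x).prm.c (Iw R x).kmaxG
/-- Width of one lower-bound test on seeds, frozen. [folklore] -/
def G1v : ℕ := uv R x * (kmaxGv R x * MG1v R x + kmaxGv R x + kmaxGv R x)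
/-- Width of one lower-bound test on `𝔽₂ⁿ`, frozen. [folklore] -/
def G2v : ℕ := uv R x * (kmaxGv R x * MG2v R x + kmaxGv R x + kmaxGv R x)
/-- Bucket bits `b = n + 6 ea`, frozen. [folklore] -/
def bv : ℕ := (Iw R x).prm.b
/-- `Σ_λ (λ n + λ)`, frozen. [folklore] -/
def sigv : ℕ := ∑ lam : Fin (x.length + 1), ((lam : ℕ) * x.length + lam)
/-- `m F`, frozen. [folklore] -/
def mFv : ℕ := (Iw R x).prm.m * 2 ^ fbitsOf R x.length
/-- Width of one occurrence secret-test hash, frozen. [folklore] -/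
def wACv : ℕ := kmaxAv R x * dCFv R x + kmaxAv R x
/-- Width of one preimage secret-test hash, frozen. [folklore] -/
def wASv : ℕ := kmaxAv R x * x.length + kmaxAv R x
/-- `offHh`, frozen. [folklore] -/
def offHhv : ℕ := offDsv R x + Mv R x * x.length
/-- `offUu`, frozen. [folklore] -/
def offUuv : ℕ := offHhv R x + mFv R x * sigv x
/-- `offGRC`, frozen. [folklore] -/
def offGRCv : ℕ := offUuv R x + mFv R x * bv R x
/-- `offGRS`, frozen. [folklore] -/
def offGRSv : ℕ := offGRCv R x + mFv R x * G1v R x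
/-- `offGPC`, frozen. [folklore] -/
def offGPCv : ℕ := offGRSv R x + mFv R x * G2v R x
/-- `offGPS`, frozen. [folklore] -/
def offGPSv : ℕ := offGPCv R x + Mv R x * G1v R x
/-- `offAC`, frozen. [folklore] -/
def offACv : ℕ := offGPSv R x + Mv R x * G2v R x
/-- `offAS`, frozen. [folklore] -/
def offASv : ℕ := offACv R x + Mv R x * wACv R x
/-- The end of the coin string, frozen. [folklore] -/
def endv : ℕ := offASv R x + Mv R x * wASv R x
/-- The claim width `(1 + ebits) + (1 + ebits)`, frozen. [folklore] -/
def wClv : ℕ := wCl R x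
/-- The offset of the pool claims `m F · wCl`, frozen. [folklore] -/
def offClv : ℕ := mFv R x * wClv R x

/-- [folklore] -/
theorem cv_def : cv R x = (Iw R x).prm.c := rfl
/-- [folklore] -/
theorem uv_def : uv R x = (Iw R x).u := rfl
/-- [folklore] -/
theorem kmaxGv_def : kmaxGv R x = (Iw R x).kmaxG := rfl
/-- [folklore] -/
theorem kmaxAv_def : kmaxAv R x = (Iw R x).kmaxA := rfl
/-- [folklore] -/
theorem b0v_def : b0v R x = (Iw R x).b₀ := rfl
/-- [folklore] -/
theorem dCFv_def : dCFv R x = dCF R x (fbitsOf R x.length) := rfl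
/-- [folklore] -/
theorem MG1v_def : MG1v R x = GSTest.M (d := dCF R x (fbitsOf R x.length)) (Iw R x).prm.c (Iw R x).kmaxG := rfl
/-- [folklore] -/
theorem MG2v_def : MG2v R x = GSTest.M (d := x.length) (Iw R x).prm.c (Iw R x).kmaxG := rfl
/-- [folklore] -/
theorem G1v_def : G1v R x = (Iw R x).u * ((Iw R x).kmaxG * GSTest.M (d := dCF R x (fbitsOf R x.length)) (Iw R x).prm.c (Iw R x).kmaxG +
    (Iw R x).kmaxG + (Iw R x).kmaxG) := rfl
/-- [folklore] -/
theorem G2v_def : G2v R x = (Iw R x).u * ((Iw R x).kmaxG * GSTest.M (d := x.length) (Iw R x).prm.c (Iw R x).kmaxG +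
    (Iw R x).kmaxG + (Iw R x).kmaxG) := rfl
/-- [folklore] -/
theorem bv_def : bv R x = (Iw R x).prm.b := rfl
/-- [folklore] -/
theorem sigv_def : sigv x = ∑ lam : Fin (x.length + 1), ((lam : ℕ) * x.length + lam) := rfl
/-- [folklore] -/
theorem mFv_def : mFv R x = (Iw R x).prm.m * 2 ^ fbitsOf R x.length := rfl
/-- [folklore] -/
theorem wACv_def : wACv R x = wAC R x := rfl
/-- [folklore] -/
theorem wASv_def : wASv R x = wAS R x := rfl
/-- [folklore] -/
theorem offHhv_def : offHhv R x = offHh R x := by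
  show offDsv R x + Mv R x * x.length = _; rw [offDsv_def, Mv_def]; dsimp only [offHh, offDs, offPs, offTy, offRuns, wPC]; omega
/-- [folklore] -/
theorem offUuv_def : offUuv R x = offUu R x := by
  show offHhv R x + _ = _; rw [offHhv_def]; rfl
/-- [folklore] -/
theorem offGRCv_def : offGRCv R x = offGRC R x := by
  show offUuv R x + _ = _; rw [offUuv_def]; rfl
/-- [folklore] -/
theorem offGRSv_def : offGRSv R x = offGRS R x := by
  show offGRCv R x + _ = _; rw [offGRCv_def]; rfl
/-- [folklore] -/
theorem offGPCv_def : offGPCv R x = offGPC R x := by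
  show offGRSv R x + _ = _; rw [offGRSv_def]; rfl
/-- [folklore] -/
theorem offGPSv_def : offGPSv R x = offGPS R x := by
  show offGPCv R x + _ = _; rw [offGPCv_def, Mv_def]; rfl
/-- [folklore] -/
theorem offACv_def : offACv R x = offAC R x := by
  show offGPSv R x + _ = _; rw [offGPSv_def, Mv_def]; rfl
/-- [folklore] -/
theorem offASv_def : offASv R x = offAS R x := by
  show offACv R x + _ = _; rw [offACv_def, Mv_def]; rfl
/-- [folklore] -/
theorem wClv_def : wClv R x = wCl R x := rfl
/-- [folklore] -/
theorem offClv_def (j : ℕ) : offClv R x + j * wClv R x = offClP R x j := rfl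

/-- **The frozen end is the coin length.** [folklore] -/
theorem endv_eq_cLen : endv R x = cLen R x := by
  show offASv R x + Mv R x * wASv R x = _
  rw [offASv_def, Mv_def, wASv_def, cLen_eq]
  dsimp only [offAS, offAC, offGPS, offGPC, offGRS, offGRC, offUu, offHh, wAS, coinLen₁, coinLen₂, dCF]
  omega

/-- One-step unfoldings (for the programmes). [folklore] -/
theorem frozen_steps :
    G1v R x = uv R x * (kmaxGv R x * MG1v R x + kmaxGv R x + kmaxGv R x) ∧
    G2v R x = uv R x * (kmaxGv R x * MG2v R x + kmaxGv R x + kmaxGv R x) ∧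
    wACv R x = kmaxAv R x * dCFv R x + kmaxAv R x ∧ wASv R x = kmaxAv R x * x.length + kmaxAv R x ∧
    offHhv R x = offDsv R x + Mv R x * x.length ∧ offUuv R x = offHhv R x + mFv R x * sigv x ∧
    offGRCv R x = offUuv R x + mFv R x * bv R x ∧ offGRSv R x = offGRCv R x + mFv R x * G1v R x ∧
    offGPCv R x = offGRSv R x + mFv R x * G2v R x ∧ offGPSv R x = offGPCv R x + Mv R x * G1v R x ∧
    offACv R x = offGPSv R x + Mv R x * G2v R x ∧ offASv R x = offACv R x + Mv R x * wACv R x ∧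
    endv R x = offASv R x + Mv R x * wASv R x ∧ offClv R x = mFv R x * wClv R x :=
  ⟨rfl, rfl, rfl, rfl, rfl, rfl, rfl, rfl, rfl, rfl, rfl, rfl, rfl, rfl⟩

/-- The arithmetic of the small frozen numbers. [folklore] -/
theorem frozen_vals :
    cv R x = 2 ^ (3 * ea (aOf R x.length)) ∧ uv R x = 2 ^ (8 * ea (aOf R x.length)) ∧
    kmaxGv R x = κOf R x.length * 2 ^ (3 * ea (aOf R x.length)) + 2 ∧ kmaxAv R x = κOf R x.length + 2 ∧
    b0v R x = 11 * ea (aOf R x.length) ∧ dCFv R x = R.coins.eval x.length + x.length + 2 ^ fbitsOf R x.length ∧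
    MG1v R x = cv R x * dCFv R x + (kmaxGv R x - 1) ∧ MG2v R x = cv R x * x.length + (kmaxGv R x - 1) ∧
    bv R x = x.length + 6 * ea (aOf R x.length) ∧ mFv R x = (Iw R x).prm.m * 2 ^ fbitsOf R x.length ∧
    wClv R x = (1 + ebitsOf R x) + (1 + ebitsOf R x) ∧
    ebitsOf R x = Nat.size (κOf R x.length * 2 ^ (3 * ea (aOf R x.length))) :=
  ⟨rfl, rfl, rfl, rfl, rfl, rfl, rfl, rfl, rfl, rfl, rfl, by rw [ebitsOf]; rfl⟩

attribute [irreducible] cv uv kmaxGv kmaxAv b0v dCFv MG1v MG2v G1v G2v bv sigv mFv wACv wASv offHhv offUuv offGRCv offGRSv offGPCv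
  offGPSv offACv offASv endv wClv offClv

/-! ### Bounds: everything is inside the coin string -/

/-- `end ≤ Lm`. [folklore] -/
theorem endv_le : endv R x ≤ Lm R x := by rw [endv_eq_cLen]; exact cLen_le R x

/-- The chain of offsets is monotone up to the end. [folklore] -/
theorem offsets_le :
    offDsv R x + Mv R x * x.length ≤ offHhv R x ∧ offHhv R x + mFv R x * sigv x ≤ offUuv R x ∧
    offUuv R x + mFv R x * bv R x ≤ offGRCv R x ∧ offGRCv R x + mFv R x * G1v R x ≤ offGRSv R x ∧
    offGRSv R x + mFv R x * G2v R x ≤ offGPCv R x ∧ offGPCv R x + Mv R x * G1v R x ≤ offGPSv R x ∧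
    offGPSv R x + Mv R x * G2v R x ≤ offACv R x ∧ offACv R x + Mv R x * wACv R x ≤ offASv R x ∧
    offASv R x + Mv R x * wASv R x ≤ Lm R x := by
  obtain ⟨-, -, -, -, h1, h2, h3, h4, h5, h6, h7, h8, h9, -⟩ := frozen_steps R x
  have h := endv_le R x
  refine ⟨?_, ?_, ?_, ?_, ?_, ?_, ?_, ?_, ?_⟩ <;> omega

/-! ### The programmes of the frozen numbers -/

/-- `c` in binary. [folklore] -/
theorem cvN : CodeFP strE natE (fun x : List Bool => cv R x) := by
  refine (powOfLe R (natMul.comp ((const _ 3).pair (eaN R))) fun x => ?_).congr fun x => by simp only; exact ((frozen_vals R x).1).symm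
  have h1 := ea_le_Tn R x; have h2 := Tn_ge R x
  exact le_Lm_of_le_pow R x (k := 2) (by nlinarith) (by norm_num)

/-- `u` in binary. [folklore] -/
theorem uvN : CodeFP strE natE (fun x : List Bool => uv R x) := by
  refine (powOfLe R (natMul.comp ((const _ 8).pair (eaN R))) fun x => ?_).congr fun x => by simp only; exact ((frozen_vals R x).2.1).symm
  have h1 := ea_le_Tn R x; have h2 := Tn_ge R x
  exact le_Lm_of_le_pow R x (k := 2) (by nlinarith) (by norm_num)

/-- `kmaxG` in binary. [folklore] -/
theorem kmaxGvN : CodeFP strE natE (fun x : List Bool => kmaxGv R x) :=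
  (natAdd.comp ((natMul.comp ((κN R).pair (cvN R))).pair (const _ 2))).congr fun x => by
    rw [(frozen_vals R x).2.2.1, (frozen_vals R x).1]

/-- `kmaxA` in binary. [folklore] -/
theorem kmaxAvN : CodeFP strE natE (fun x : List Bool => kmaxAv R x) :=
  (natAdd.comp ((κN R).pair (const _ 2))).congr fun x => by simp only; exact ((frozen_vals R x).2.2.2.1).symm

/-- `b₀` in binary. [folklore] -/
theorem b0vN : CodeFP strE natE (fun x : List Bool => b0v R x) :=
  (natMul.comp ((const _ 11).pair (eaN R))).congr fun x => by simp only; exact ((frozen_vals R x).2.2.2.2.1).symm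

/-- `dCF` in binary. [folklore] -/
theorem dCFvN : CodeFP strE natE (fun x : List Bool => dCFv R x) :=
  (natAdd.comp ((natAdd.comp ((polyN R.coins).pair nN)).pair (FN R))).congr fun x => by simp only; exact ((frozen_vals R x).2.2.2.2.2.1).symm

/-- `MG1` in binary. [folklore] -/
theorem MG1vN : CodeFP strE natE (fun x : List Bool => MG1v R x) :=
  (natAdd.comp ((natMul.comp ((cvN R).pair (dCFvN R))).pair (natSub.comp ((kmaxGvN R).pair (const _ 1))))).congr fun x => by
    simp only; exact ((frozen_vals R x).2.2.2.2.2.2.1).symm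

/-- `MG2` in binary. [folklore] -/
theorem MG2vN : CodeFP strE natE (fun x : List Bool => MG2v R x) :=
  (natAdd.comp ((natMul.comp ((cvN R).pair nN)).pair (natSub.comp ((kmaxGvN R).pair (const _ 1))))).congr fun x => by
    simp only; exact ((frozen_vals R x).2.2.2.2.2.2.2.1).symm

/-- `G1` in binary. [folklore] -/
theorem G1vN : CodeFP strE natE (fun x : List Bool => G1v R x) :=
  (natMul.comp ((uvN R).pair (natAdd.comp ((natAdd.comp ((natMul.comp ((kmaxGvN R).pair (MG1vN R))).pair (kmaxGvN R))).pair
    (kmaxGvN R))))).congr fun x => by simp only; exact ((frozen_steps R x).1).symm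

/-- `G2` in binary. [folklore] -/
theorem G2vN : CodeFP strE natE (fun x : List Bool => G2v R x) :=
  (natMul.comp ((uvN R).pair (natAdd.comp ((natAdd.comp ((natMul.comp ((kmaxGvN R).pair (MG2vN R))).pair (kmaxGvN R))).pair
    (kmaxGvN R))))).congr fun x => by simp only; exact ((frozen_steps R x).2.1).symm

/-- `b` in binary. [folklore] -/
theorem bvN : CodeFP strE natE (fun x : List Bool => bv R x) :=
  (natAdd.comp (nN.pair (natMul.comp ((const _ 6).pair (eaN R))))).congr fun x => by simp only; exact ((frozen_vals R x).2.2.2.2.2.2.2.2.1).symm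

/-- `Σ` in binary (closed form). [folklore] -/
theorem sigvN : CodeFP strE natE (fun x : List Bool => sigv x) :=
  (natMul.comp ((natAdd.comp (nN.pair (const _ 1))).pair (natDiv.comp ((natMul.comp (nN.pair (natAdd.comp (nN.pair (const _ 1))))).pair
    (const _ 2))))).congr fun x => by rw [sigv_def, sigma_closed]

/-- `m F` in binary. [folklore] -/
theorem mFvN : CodeFP strE natE (fun x : List Bool => mFv R x) := (mFN R).congr fun x => by rw [mFv_def]

/-- `wAC` in binary. [folklore] -/
theorem wACvN : CodeFP strE natE (fun x : List Bool => wACv R x) :=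
  (natAdd.comp ((natMul.comp ((kmaxAvN R).pair (dCFvN R))).pair (kmaxAvN R))).congr fun x => by simp only; exact ((frozen_steps R x).2.2.1).symm

/-- `wAS` in binary. [folklore] -/
theorem wASvN : CodeFP strE natE (fun x : List Bool => wASv R x) :=
  (natAdd.comp ((natMul.comp ((kmaxAvN R).pair nN)).pair (kmaxAvN R))).congr fun x => by simp only; exact ((frozen_steps R x).2.2.2.1).symm

/-- `offHh` in binary. [folklore] -/
theorem offHhvN : CodeFP strE natE (fun x : List Bool => offHhv R x) :=
  (natAdd.comp ((offDsvN R).pair (natMul.comp ((MvN R).pair nN)))).congr fun x => by simp only; exact ((frozen_steps R x).2.2.2.2.1).symm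

/-- `offUu` in binary. [folklore] -/
theorem offUuvN : CodeFP strE natE (fun x : List Bool => offUuv R x) :=
  (natAdd.comp ((offHhvN R).pair (natMul.comp ((mFvN R).pair sigvN)))).congr fun x => by simp only; exact ((frozen_steps R x).2.2.2.2.2.1).symm

/-- `offGRC` in binary. [folklore] -/
theorem offGRCvN : CodeFP strE natE (fun x : List Bool => offGRCv R x) :=
  (natAdd.comp ((offUuvN R).pair (natMul.comp ((mFvN R).pair (bvN R))))).congr fun x => by simp only; exact ((frozen_steps R x).2.2.2.2.2.2.1).symm

/-- `offGRS` in binary. [folklore] -/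
theorem offGRSvN : CodeFP strE natE (fun x : List Bool => offGRSv R x) :=
  (natAdd.comp ((offGRCvN R).pair (natMul.comp ((mFvN R).pair (G1vN R))))).congr fun x => by simp only; exact ((frozen_steps R x).2.2.2.2.2.2.2.1).symm

/-- `offGPC` in binary. [folklore] -/
theorem offGPCvN : CodeFP strE natE (fun x : List Bool => offGPCv R x) :=
  (natAdd.comp ((offGRSvN R).pair (natMul.comp ((mFvN R).pair (G2vN R))))).congr fun x => by simp only; exact ((frozen_steps R x).2.2.2.2.2.2.2.2.1).symm

/-- `offGPS` in binary. [folklore] -/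
theorem offGPSvN : CodeFP strE natE (fun x : List Bool => offGPSv R x) :=
  (natAdd.comp ((offGPCvN R).pair (natMul.comp ((MvN R).pair (G1vN R))))).congr fun x => by simp only; exact ((frozen_steps R x).2.2.2.2.2.2.2.2.2.1).symm

/-- `offAC` in binary. [folklore] -/
theorem offACvN : CodeFP strE natE (fun x : List Bool => offACv R x) :=
  (natAdd.comp ((offGPSvN R).pair (natMul.comp ((MvN R).pair (G2vN R))))).congr fun x => by simp only; exact ((frozen_steps R x).2.2.2.2.2.2.2.2.2.2.1).symm

/-- `offAS` in binary. [folklore] -/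
theorem offASvN : CodeFP strE natE (fun x : List Bool => offASv R x) :=
  (natAdd.comp ((offACvN R).pair (natMul.comp ((MvN R).pair (wACvN R))))).congr fun x => by simp only; exact ((frozen_steps R x).2.2.2.2.2.2.2.2.2.2.2.1).symm

/-- **`ebits = ⌊log₂ (κ c)⌋ + 1` in binary.** [folklore] -/
theorem ebN : CodeFP strE natE (fun x : List Bool => ebitsOf R x) := by
  have hE : CodeFP strE natE (fun x : List Bool => κOf R x.length * 2 ^ (3 * ea (aOf R x.length))) :=
    (natMul.comp ((κN R).pair (cvN R))).congr fun x => by simp only; rw [(frozen_vals R x).1]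
  have hpos : ∀ x : List Bool, κOf R x.length * 2 ^ (3 * ea (aOf R x.length)) ≠ 0 := fun x => by
    have : 1 ≤ κOf R x.length := by unfold κOf; have := Nat.succ_le_of_lt (Nat.zero_lt_succ (Nat.log 2 (R.fuel.eval x.length))); rw [Sizes.fbitsOf]; omega
    positivity
  have hle : ∀ x : List Bool, Nat.log 2 (κOf R x.length * 2 ^ (3 * ea (aOf R x.length))) ≤ Lm R x := fun x => by
    refine (Nat.log_le_self 2 _).trans (le_Lm_of_le_pow R x (k := 4) ?_ (by norm_num))
    have h1 := κOf_le R x; have h3 : 2 ^ (3 * ea (aOf R x.length)) = Tn R x ^ 3 := by rw [Tn, ← pow_mul, Nat.mul_comm]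
    rw [h3, pow_one] at *; calc _ ≤ Tn R x * Tn R x ^ 3 := Nat.mul_le_mul_right _ h1
      _ = Tn R x ^ 4 := by ring
  have hlog : CodeFP strE natE (fun x : List Bool => min (Lm R x) (Nat.log 2 (κOf R x.length * 2 ^ (3 * ea (aOf R x.length))))) :=
    (natLog2Min.comp (hE.pair ((replicateUnit.comp (LmU R)).congr fun _ => rfl))).congr fun x => by simp
  refine (natAdd.comp (hlog.pair (const _ 1))).congr fun x => ?_
  simp only
  rw [min_eq_right (hle x), (frozen_vals R x).2.2.2.2.2.2.2.2.2.2.2, size_eq_log_succ (hpos x)]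

/-- `wCl` in binary. [folklore] -/
theorem wClvN : CodeFP strE natE (fun x : List Bool => wClv R x) :=
  (natAdd.comp ((natAdd.comp ((const _ 1).pair (ebN R))).pair (natAdd.comp ((const _ 1).pair (ebN R))))).congr fun x => by
    simp only; exact ((frozen_vals R x).2.2.2.2.2.2.2.2.2.2.1).symm

/-- `offCl` in binary. [folklore] -/
theorem offClvN : CodeFP strE natE (fun x : List Bool => offClv R x) :=
  (natMul.comp ((mFvN R).pair (wClvN R))).congr fun x => by simp only; exact ((frozen_steps R x).2.2.2.2.2.2.2.2.2.2.2.2.2).symm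

/-- **The pool claims are inside the message**: `offCl + M · wCl = len₁' ≤ Lm`. [folklore] -/
theorem claims_le : offClv R x + Mv R x * wClv R x ≤ Lm R x := by
  have h := (len_le R x).2.1
  rw [(frozen_steps R x).2.2.2.2.2.2.2.2.2.2.2.2.2, mFv_def, Mv_def, wClv_def]
  exact h

end AppD

end Literature.Barriers.PneNP

end
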